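import Literature.AlgebraicGeometry.Motives.HodgeLieWeightOneMinimalRaising
import Literature.AlgebraicGeometry.Motives.HodgeLieWeightOneProjector
import HarnessLib

/-!
# Weight one: the Peirce-`1` space of a minimal raising tripotent — either `range B ⊕ range B̄` is `𝔤_ℂ`-stable
# (so the minimal raising rank is `dim V^{1,0}`), or `3 · (minimal raising rank) ≤ 2 · dim V^{1,0}`
# (Moonen–Zarhin 1999 (2.3); Loos' Peirce decomposition in the raising space)

Family `hodge`, layer `Literature/AlgebraicGeometry/Motives`; THEOREMS ONLY (no definition, no named fact; D-0026).  Written for the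
cell `pub-hodgeav-hg6` (LADDER-HodgeAV row 2, TABLE X row 1 `g6.I(1)`: brick N5 of the row-1 programme «`End⁰ = ℚ`, `g = 6` ⟹
`Hg = Sp₁₂`»; honest framing of that cell: HC / HC_AV / HC_CM NOT proved — this file is unconditional Hodge–Lie linear algebra).
Sequel of `HodgeLieWeightOneMinimalRaising` (N4: a raising `B ≠ 0` of minimal rank `r` in a bracket-closed `𝔊 ⊆ 𝔥_ℂ` is a
tripotent, `B B̄ B = t B`, `t ≠ 0`).

SETTING.  `H` effective polarized of weight `1`, `P = V^{1,0}`, `Q = V^{0,1}`, `Θ` the Hodge operator; `𝔊 ⊆ 𝔥_ℂ` bracket-closed,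
containing `Θ`, stable under `Y ↦ Ȳ = conj ∘ Y ∘ conj`; `B ∈ 𝔊` raising, non-zero, of minimal rank `r`, `C = B̄`.  Put
`E = t⁻¹ B C` (idempotent, `range E = range B ⊆ P`) and `F = t⁻¹ C B` (idempotent, `range F = range C ⊆ Q`); the Levi element
`h = t⁻¹ [B, C] = E − F ∈ 𝔊` acts on a raising `x` by `[h, x] = E x + x F`, with eigenvalues `2, 1, 0` (Peirce decomposition
`x = E x F + (E x (1 − F) + (1 − E) x F) + (1 − E) x (1 − F)`, each component again in `𝔊`: `…peirceOne_mem`).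

* §0 operator identities (`levi_bracket_eq`, `tripotent_facts`, `peirceOne_mem`, `apply_mem_range_of_levi`,
  `apply_mem_range_of_raising`); §1 `conjOp_mul_conjOp_mul`: `C B C = t C` and `t̄ = t`.
* §2 **`WeightOnePeirce.stable_or_three_mul_rank_le`** — EITHER `range B ⊔ range C` is `𝔊`-stable, OR `3 r ≤ 2 dim P`.
  PROOF.  If some raising `x ∈ 𝔊` has a non-zero Peirce-`1` component `x₁ = E x (1 − F) + (1 − E) x F ∈ 𝔊` (raising), then
  `r ≤ rank x₁` (minimality) while `E x (1 − F)` kills `P ⊕ range C` (rank `≤ dim Q − r`) and `(1 − E) x F` takes values in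
  `(1 − E) P` (rank `≤ dim P − r`), so `r ≤ 2 (dim P − r)`.  If every raising Peirce-`1` component vanishes, then raising
  elements map `range C` into `range B` (`x F = E x F`), lowering elements map `range B` into `range C` (conjugate), and for a
  Levi-type `l ∈ 𝔊` (`l P ⊆ P`) the vanishing of the Peirce-`1` part of the raising `[l, B]` gives `l B = E l B`, i.e.
  `l (range B) ⊆ range B` (and `l̄` gives `l (range C) ⊆ range C`); with `Z = Z⁺ + Z⁻ + Z⁰` (`UnitaryTheta.raise_mem`) the sum
  `range B ⊔ range C` is `𝔊`-stable.
* §3 **`WeightOnePeirce.finrank_range_eq_or_three_mul_le`** — if moreover `V_ℂ` has no `𝔊`-stable subspace other than `0` and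
  `V_ℂ`, then `r = dim P` or `3 r ≤ 2 dim P`; **`…forall_scalar_of_finrank_range_eq`** — if `r = dim P` then EVERY raising
  `B' ∈ 𝔊` has `B' B̄'|_P` scalar (the hypothesis of the tree's `SymplecticThetaTen.plusLine_of_forall_scalar`: plus-line
  position); **`…finrank_range_ne_five`** — for `dim P = 6` the minimal raising rank is not `5` (it is `1, 2, 3, 4` or the
  plus-line value `6`).  For the cell's row 1 (`dim_ℚ V = 12`, `End_Hdg = ℚ`): `r = 1` gives `Hg = Sp₁₂` (N4 §2), `r = 6` the
  plus pair (excluded by `not_plusPair_of_finrank_eq_twelve`), `r = 5` is excluded here; `r ∈ {2, 3, 4}` remains.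

## References

* [MoonenZarhin1999LowDim] B. Moonen, Yu. Zarhin, *Hodge classes on abelian varieties of low dimension*, Math. Ann. 315 (1999),
  §2 (2.3)–(2.5).
* [Deligne1982HodgeCycles] P. Deligne, *Hodge cycles on abelian varieties*, LNM 900 (1982), I §3 (proof of Prop. 3.4, 3.6).
* O. Loos, *Bounded symmetric domains and Jordan pairs* (Irvine 1977), §3 (Peirce decomposition; terminology only, not a cite key).
* [GoodmanWallachGTM255] R. Goodman, N. R. Wallach, GTM 255 (2009), §2.1.2, §4.1.1.
-/

noncomputable section

open scoped TensorProduct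

namespace Literature.AlgebraicGeometry.Motives

namespace HodgeStructure

universe u

/-! ## §0 Operator identities for a tripotent `B C B = t B`, `C B C = t C`, `B² = C² = 0` -/

section Algebra

variable {M : Type*} [AddCommGroup M] [Module ℂ M]

/-- The Levi element `h = t⁻¹ [B, C]` brackets an `x` with `x B = 0 = B x` to `[h, x] = (t⁻¹ B C) x + x (t⁻¹ C B)`.
[cite: GoodmanWallachGTM255, §2.1.2] -/
theorem WeightOnePeirce.levi_bracket_eq (B C x : Module.End ℂ M) (t : ℂ) (hxB : x * B = 0) (hBx : B * x = 0) :
    t⁻¹ • (B * C - C * B) * x - x * (t⁻¹ • (B * C - C * B)) = t⁻¹ • (B * C) * x + x * (t⁻¹ • (C * B)) := by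
  have h1 : C * B * x = 0 := by rw [mul_assoc, hBx, mul_zero]
  have h2 : x * (B * C) = 0 := by rw [← mul_assoc, hxB, zero_mul]
  simp only [smul_mul_assoc, mul_smul_comm, sub_mul, mul_sub, h1, h2, sub_zero, zero_sub, smul_neg, sub_neg_eq_add]

/-- Identities for the idempotents `E = t⁻¹ B C`, `F = t⁻¹ C B` of a tripotent pair (`B C B = t B`, `C B C = t C`,
`B² = C² = 0`, `t ≠ 0`): `E² = E`, `F² = F`, `E B = B = B F`, `F C = C = C E`, `B E = F B = E F = F E = 0`.
[cite: GoodmanWallachGTM255, §2.1.2] -/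
theorem WeightOnePeirce.tripotent_facts {B C E F : Module.End ℂ M} {t : ℂ} (ht : t ≠ 0) (hBCB : B * C * B = t • B)
    (hCBC : C * B * C = t • C) (hBB : B * B = 0) (hCC : C * C = 0) (hE : E = t⁻¹ • (B * C))
    (hF : F = t⁻¹ • (C * B)) :
    E * E = E ∧ F * F = F ∧ E * B = B ∧ B * F = B ∧ F * C = C ∧ C * E = C ∧ B * E = 0 ∧ F * B = 0 ∧
      E * F = 0 ∧ F * E = 0 := by
  subst hE hF
  refine ⟨?_, ?_, ?_, ?_, ?_, ?_, ?_, ?_, ?_, ?_⟩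
  · rw [smul_mul_smul_comm, ← mul_assoc, hBCB, smul_mul_assoc, smul_smul, mul_assoc t⁻¹ t⁻¹ t, inv_mul_cancel₀ ht,
      mul_one]
  · rw [smul_mul_smul_comm, mul_assoc C B (C * B), ← mul_assoc B C B, hBCB, mul_smul_comm, smul_smul,
      mul_assoc t⁻¹ t⁻¹ t, inv_mul_cancel₀ ht, mul_one]
  · rw [smul_mul_assoc, hBCB, smul_smul, inv_mul_cancel₀ ht, one_smul]
  · rw [mul_smul_comm, ← mul_assoc, hBCB, smul_smul, inv_mul_cancel₀ ht, one_smul]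
  · rw [smul_mul_assoc, hCBC, smul_smul, inv_mul_cancel₀ ht, one_smul]
  · rw [mul_smul_comm, ← mul_assoc, hCBC, smul_smul, inv_mul_cancel₀ ht, one_smul]
  · rw [mul_smul_comm, ← mul_assoc, hBB, zero_mul, smul_zero]
  · rw [smul_mul_assoc, mul_assoc, hBB, mul_zero, smul_zero]
  · rw [smul_mul_smul_comm, show B * C * (C * B) = B * (C * C) * B by simp only [mul_assoc], hCC, mul_zero, zero_mul,
      smul_zero]
  · rw [smul_mul_smul_comm, show C * B * (B * C) = C * (B * B) * C by simp only [mul_assoc], hBB, mul_zero, zero_mul,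
      smul_zero]

/-- **The Peirce components of a raising element lie in `𝔊`.**  For `𝔊` bracket-closed containing the tripotent pair
`B, C` and `x ∈ 𝔊` with `x B = 0 = B x`: `E x F ∈ 𝔊` (Peirce `2`) and `E x + x F − 2 E x F ∈ 𝔊` (Peirce `1`), since
`[h, x] = E x + x F` and `[h, [h, x]] = E x + x F + 2 E x F` for `h = t⁻¹[B, C]`. [cite: MoonenZarhin1999LowDim, §2 (2.3)]
[cite: GoodmanWallachGTM255, §2.1.2] -/
theorem WeightOnePeirce.peirceOne_mem {𝔊 : Submodule ℂ (Module.End ℂ M)}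
    (hbr : ∀ Y ∈ 𝔊, ∀ Z ∈ 𝔊, Y * Z - Z * Y ∈ 𝔊) {B C x E F : Module.End ℂ M} {t : ℂ} (ht : t ≠ 0)
    (hBCB : B * C * B = t • B) (hCBC : C * B * C = t • C) (hBB : B * B = 0) (hCC : C * C = 0)
    (hE : E = t⁻¹ • (B * C)) (hF : F = t⁻¹ • (C * B)) (hB : B ∈ 𝔊) (hC : C ∈ 𝔊) (hx : x ∈ 𝔊) (hxB : x * B = 0)
    (hBx : B * x = 0) : E * x * F ∈ 𝔊 ∧ E * x + x * F - (2 : ℂ) • (E * x * F) ∈ 𝔊 := by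
  obtain ⟨hEE, hFF, -, -, -, -, hBE, hFB, -, -⟩ := WeightOnePeirce.tripotent_facts ht hBCB hCBC hBB hCC hE hF
  have hh : t⁻¹ • (B * C - C * B) ∈ 𝔊 := Submodule.smul_mem _ _ (hbr B hB C hC)
  have hy : t⁻¹ • (B * C - C * B) * x - x * (t⁻¹ • (B * C - C * B)) = E * x + x * F := by
    rw [WeightOnePeirce.levi_bracket_eq B C x t hxB hBx, hE, hF]
  have hymem : E * x + x * F ∈ 𝔊 := hy ▸ hbr _ hh x hx
  have hyB : (E * x + x * F) * B = 0 := by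
    rw [add_mul, mul_assoc E x B, hxB, mul_zero, zero_add, mul_assoc x F B, hFB, mul_zero]
  have hBy : B * (E * x + x * F) = 0 := by
    rw [mul_add, ← mul_assoc B E x, hBE, zero_mul, zero_add, ← mul_assoc B x F, hBx, zero_mul]
  have hz : t⁻¹ • (B * C - C * B) * (E * x + x * F) - (E * x + x * F) * (t⁻¹ • (B * C - C * B)) =
      E * x + x * F + (2 : ℂ) • (E * x * F) := by
    rw [WeightOnePeirce.levi_bracket_eq B C _ t hyB hBy, ← hE, ← hF, mul_add, add_mul, ← mul_assoc E E x, hEE,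
      ← mul_assoc E x F, mul_assoc x F F, hFF, two_smul]
    abel
  have hzmem : E * x + x * F + (2 : ℂ) • (E * x * F) ∈ 𝔊 := hz ▸ hbr _ hh _ hymem
  have hExF : E * x * F ∈ 𝔊 := by
    have h : E * x * F = (2 : ℂ)⁻¹ • ((E * x + x * F + (2 : ℂ) • (E * x * F)) - (E * x + x * F)) := by module
    rw [h]
    exact Submodule.smul_mem _ _ (Submodule.sub_mem _ hzmem hymem)
  exact ⟨hExF, Submodule.sub_mem _ hymem (Submodule.smul_mem _ _ hExF)⟩

/-- **Levi stability from the vanishing of a Peirce-`1` component.**  If the raising element `[l, B] = l B − B l` has zero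
Peirce-`1` component, then `l B = E l B`, so `l` maps `range B` into `range B`. [cite: MoonenZarhin1999LowDim, §2 (2.3)]
[cite: GoodmanWallachGTM255, §2.1.2] -/
theorem WeightOnePeirce.apply_mem_range_of_levi {B C l E F : Module.End ℂ M} {t : ℂ} (ht : t ≠ 0)
    (hBCB : B * C * B = t • B) (hCBC : C * B * C = t • C) (hBB : B * B = 0) (hCC : C * C = 0)
    (hE : E = t⁻¹ • (B * C)) (hF : F = t⁻¹ • (C * B))
    (h0 : E * (l * B - B * l) + (l * B - B * l) * F - (2 : ℂ) • (E * (l * B - B * l) * F) = 0) (v : M) :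
    l (B v) ∈ LinearMap.range B := by
  obtain ⟨hEE, -, hEB, hBF, -, -, -, -, -, -⟩ := WeightOnePeirce.tripotent_facts ht hBCB hCBC hBB hCC hE hF
  have h1 : E * (l * B - B * l) = E * l * B - B * l := by rw [mul_sub, ← mul_assoc E l B, ← mul_assoc E B l, hEB]
  have h2 : (l * B - B * l) * F = l * B - B * l * F := by rw [sub_mul, mul_assoc l B F, hBF]
  have h3 : E * (l * B - B * l) * F = E * l * B - B * l * F := by rw [h1, sub_mul, mul_assoc (E * l) B F, hBF]
  rw [h3, h1, h2] at h0
  have h4 : B * l * F = B * l := by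
    have h := congrArg (fun X => E * X) h0
    have hexp : E * (E * l * B - B * l + (l * B - B * l * F) - (2 : ℂ) • (E * l * B - B * l * F)) =
        -(B * l) + B * l * F := by
      rw [mul_sub, mul_add, mul_sub, mul_sub, mul_smul_comm, mul_sub, ← mul_assoc E (E * l) B, ← mul_assoc E E l, hEE,
        ← mul_assoc E B l, hEB, ← mul_assoc E l B, ← mul_assoc E (B * l) F, ← mul_assoc E B l, hEB]
      module
    simp only [hexp, mul_zero] at h
    rw [← sub_eq_zero, ← neg_add_eq_sub]
    exact h
  have h5 : l * B = E * l * B := by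
    rw [h4] at h0
    rw [← sub_eq_zero, ← h0]
    module
  have h6 : l (B v) = (E * l * B) v := by rw [← h5]; rfl
  rw [h6, hE]
  simp only [Module.End.mul_apply, LinearMap.smul_apply]
  exact Submodule.smul_mem _ _ (LinearMap.mem_range_self B _)

/-- **Raising elements with zero Peirce-`1` component map `range C` into `range B`** (`x F = E x F` and `F C = C`).
[cite: MoonenZarhin1999LowDim, §2 (2.3)] [cite: GoodmanWallachGTM255, §2.1.2] -/
theorem WeightOnePeirce.apply_mem_range_of_raising {B C x E F : Module.End ℂ M} {t : ℂ} (ht : t ≠ 0)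
    (hBCB : B * C * B = t • B) (hCBC : C * B * C = t • C) (hBB : B * B = 0) (hCC : C * C = 0)
    (hE : E = t⁻¹ • (B * C)) (hF : F = t⁻¹ • (C * B)) (h0 : E * x + x * F - (2 : ℂ) • (E * x * F) = 0) (v : M) :
    x (C v) ∈ LinearMap.range B := by
  obtain ⟨-, hFF, -, -, hFC, -, -, -, -, -⟩ := WeightOnePeirce.tripotent_facts ht hBCB hCBC hBB hCC hE hF
  have h1 : x * F = E * x * F := by
    have h := congrArg (fun X => X * F) h0
    have hexp : (E * x + x * F - (2 : ℂ) • (E * x * F)) * F = E * x * F + x * F - (2 : ℂ) • (E * x * F) := by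
      rw [sub_mul, add_mul, smul_mul_assoc, mul_assoc x F F, hFF, mul_assoc (E * x) F F, hFF]
    simp only [hexp, zero_mul] at h
    rw [← sub_eq_zero, ← h]
    module
  have h2 : x (C v) = (x * F) (C v) := by
    conv_lhs => rw [← hFC]
    rfl
  rw [h2, h1, hE]
  simp only [Module.End.mul_apply, LinearMap.smul_apply]
  exact Submodule.smul_mem _ _ (LinearMap.mem_range_self B _)

end Algebra

variable {V : Type u} [AddCommGroup V] [Module ℚ V] [Module.Finite ℚ V] [HodgeTensorFacts.{u, u}] {n : ℤ}

/-! ## §1 The conjugate tripotent identity `C B C = t C`, `t̄ = t` -/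

omit [Module.Finite ℚ V] [HodgeTensorFacts.{u, u}] in
/-- **`B B̄ B = t B` implies `B̄ B B̄ = t B̄` and `t ∈ ℝ`** (`B ≠ 0`, `t ≠ 0`): conjugating gives `B̄ B B̄ = t̄ B̄`, and comparing
`(B B̄)(B B̄) = t B B̄ = t̄ B B̄` gives `t = t̄`. [cite: Deligne1982HodgeCycles, I §3 (proof of Prop. 3.4)]
[cite: MoonenZarhin1999LowDim, §2 (2.3)] -/
theorem WeightOnePeirce.conjOp_mul_conjOp_mul {B C : Module.End ℂ (ℂ ⊗[ℚ] V)} (hC : ∀ v, C v = conj (B (conj v)))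
    {t : ℂ} (ht : t ≠ 0) (hB0 : B ≠ 0) (hBCB : B * C * B = t • B) :
    C * B * C = t • C ∧ starRingEnd ℂ t = t := by
  have hcB : ∀ v, conj (B v) = C (conj v) := fun v => by rw [hC, conj_conj]
  have hcC : ∀ v, conj (C v) = B (conj v) := fun v => by rw [hC, conj_conj]
  have h1 : C * B * C = starRingEnd ℂ t • C := LinearMap.ext fun v => by
    have h := congrArg (fun X : Module.End ℂ (ℂ ⊗[ℚ] V) => X (conj v)) hBCB
    simp only [Module.End.mul_apply, LinearMap.smul_apply] at h
    simp only [Module.End.mul_apply, LinearMap.smul_apply]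
    rw [hC (B (C v)), hcB (C v), hcC v, h, conj_smul, ← hC]
  have e1 : t • (B * C) = B * C * B * C := by rw [hBCB, smul_mul_assoc]
  have e2 : starRingEnd ℂ t • (B * C) = B * C * B * C := by
    rw [show B * C * B * C = B * (C * B * C) by simp only [mul_assoc], h1, mul_smul_comm]
  have h2 : (t - starRingEnd ℂ t) • (B * C) = 0 := by
    rw [show (t - starRingEnd ℂ t) • (B * C) = t • (B * C) - starRingEnd ℂ t • (B * C) from
      sub_smul t (starRingEnd ℂ t) (B * C), e1, e2,
      sub_self]
  have hBC : B * C ≠ 0 := fun h => hB0 (by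
    have h' : t • B = 0 := by rw [← hBCB, h, zero_mul]
    exact (smul_eq_zero.1 h').resolve_left ht)
  have ht' : starRingEnd ℂ t = t := by
    have h := (smul_eq_zero.1 h2).resolve_right hBC
    exact (sub_eq_zero.1 h).symm
  exact ⟨by rw [h1, ht'], ht'⟩

/-! ## §2 The dichotomy: `range B ⊔ range B̄` is `𝔊`-stable, or `3 · rank B ≤ 2 · dim V^{1,0}` -/

set_option maxHeartbeats 1600000 in
/-- **Peirce-`1` dichotomy for a minimal raising tripotent.**  `H` effective polarized of weight `1`; `𝔊 ⊆ 𝔥_ℂ` bracket-closed,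
containing `Θ`, conjugation-stable; `B ∈ 𝔊` raising, non-zero, of minimal rank `r`, `C = B̄`.  Then EITHER `range B ⊔ range C`
is stable under every element of `𝔊`, OR `3 r ≤ 2 dim V^{1,0}` (a non-zero Peirce-`1` component of a raising element of `𝔊` is
a raising element of `𝔊` of rank between `r` and `2 (dim V^{1,0} − r)`). [cite: MoonenZarhin1999LowDim, §2 (2.3)–(2.5)]
[cite: Deligne1982HodgeCycles, I §3 (proof of Prop. 3.4, 3.6)] [cite: GoodmanWallachGTM255, §2.1.2, §4.1.1] -/
theorem WeightOnePeirce.stable_or_three_mul_rank_le (H : HodgeStructure V n) (ψ : H.Polarization) (hn : n = 1)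
    (heff : H.IsEffective) {Θ : Module.End ℂ (ℂ ⊗[ℚ] V)} (hΘ : ∀ p, ∀ x ∈ H.piece p (n - p), Θ x = ((2 * p - n : ℤ) : ℂ) • x)
    {𝔊 : Submodule ℂ (Module.End ℂ (ℂ ⊗[ℚ] V))} (h𝔊 : 𝔊 ≤ H.hodgeLieC) (hbr : ∀ Y ∈ 𝔊, ∀ Z ∈ 𝔊, Y * Z - Z * Y ∈ 𝔊)
    (hΘ𝔊 : Θ ∈ 𝔊) (hconj : ∀ Z ∈ 𝔊, ∀ Z' : Module.End ℂ (ℂ ⊗[ℚ] V), (∀ v, Z' v = conj (Z (conj v))) → Z' ∈ 𝔊)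
    {B C : Module.End ℂ (ℂ ⊗[ℚ] V)} (hB : B ∈ 𝔊) (hB0 : B ≠ 0) (hBP : ∀ p ∈ H.piece 1 0, B p = 0)
    (hBim : ∀ v, B v ∈ H.piece 1 0) (hC : ∀ v, C v = conj (B (conj v)))
    (hmin : ∀ B' ∈ 𝔊, B' ≠ 0 → (∀ p ∈ H.piece 1 0, B' p = 0) → (∀ v, B' v ∈ H.piece 1 0) →
      Module.finrank ℂ (LinearMap.range B) ≤ Module.finrank ℂ (LinearMap.range B')) :
    (∀ Z ∈ 𝔊, ∀ s ∈ LinearMap.range B ⊔ LinearMap.range C, Z s ∈ LinearMap.range B ⊔ LinearMap.range C) ∨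
      3 * Module.finrank ℂ (LinearMap.range B) ≤ 2 * Module.finrank ℂ (H.piece 1 0) := by
  classical
  have hC𝔊 : C ∈ 𝔊 := hconj B hB C hC
  obtain ⟨t, ht, hBCB⟩ :=
    WeightOneMinimalRaising.mul_conjOp_mul_eq_smul H ψ hn heff hΘ h𝔊 hbr hB hB0 hBP hBim hC hC𝔊 hmin
  obtain ⟨hCBC, -⟩ := WeightOnePeirce.conjOp_mul_conjOp_mul hC ht hB0 hBCB
  subst hn
  obtain ⟨hPmem, hQmem, hΘ10, hΘ01, hΘΘ⟩ := UnitaryTheta.theta_facts H rfl heff hΘ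
  obtain ⟨hCQ, hCim, hcC, hcB⟩ := SymplecticThetaTen.conjOp_raise (P := H.piece 1 0) (Q := H.piece 0 1)
    (fun x hx => conj_mem_piece H hx) (fun x hx => conj_mem_piece H hx) hBP hBim hC
  have hTfix : ∀ x : ℂ ⊗[ℚ] V, Θ x = x → x ∈ H.piece 1 0 := fun x hx => by
    have h := hPmem x
    rwa [hx, ← two_smul ℂ x, smul_smul, inv_mul_cancel₀ (two_ne_zero' ℂ), one_smul] at h
  have hTneg : ∀ x : ℂ ⊗[ℚ] V, Θ x = -x → x ∈ H.piece 0 1 := fun x hx => by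
    have h := hQmem x
    rwa [hx, sub_neg_eq_add, ← two_smul ℂ x, smul_smul, inv_mul_cancel₀ (two_ne_zero' ℂ), one_smul] at h
  have hBB : B * B = 0 := LinearMap.ext fun v => by
    rw [Module.End.mul_apply, hBP _ (hBim v), LinearMap.zero_apply]
  have hCC : C * C = 0 := LinearMap.ext fun v => by
    rw [Module.End.mul_apply, hCQ _ (hCim v), LinearMap.zero_apply]
  obtain ⟨E, hE⟩ : ∃ E : Module.End ℂ (ℂ ⊗[ℚ] V), E = t⁻¹ • (B * C) := ⟨_, rfl⟩
  obtain ⟨F, hF⟩ : ∃ F : Module.End ℂ (ℂ ⊗[ℚ] V), F = t⁻¹ • (C * B) := ⟨_, rfl⟩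
  obtain ⟨-, -, hEB, -, hFC, -, -, -, -, -⟩ := WeightOnePeirce.tripotent_facts ht hBCB hCBC hBB hCC hE hF
  have hEP : ∀ v, E v ∈ H.piece 1 0 := fun v => by
    rw [hE, LinearMap.smul_apply, Module.End.mul_apply]
    exact Submodule.smul_mem _ _ (hBim _)
  have hFP : ∀ p ∈ H.piece 1 0, F p = 0 := fun p hp => by
    rw [hF, LinearMap.smul_apply, Module.End.mul_apply, hBP p hp, map_zero, smul_zero]
  have hBle : LinearMap.range B ≤ H.piece 1 0 := by
    rintro _ ⟨w, rfl⟩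
    exact hBim w
  have hCle : LinearMap.range C ≤ H.piece 0 1 := by
    rintro _ ⟨w, rfl⟩
    exact hCim w
  -- `rank C ≥ rank B` (`B C B = t B`)
  have hrC : Module.finrank ℂ (LinearMap.range B) ≤ Module.finrank ℂ (LinearMap.range C) := by
    have h1 : LinearMap.range B = LinearMap.range (B * C * B) := by rw [hBCB, LinearMap.range_smul _ _ ht]
    have h2 : LinearMap.range (B * C * B) ≤ LinearMap.range (B * C) := by
      rw [Module.End.mul_eq_comp (B * C) B]
      exact LinearMap.range_comp_le_range _ _
    have h3 : LinearMap.range (B * C) = Submodule.map B (LinearMap.range C) := by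
      rw [Module.End.mul_eq_comp, LinearMap.range_comp]
    calc Module.finrank ℂ (LinearMap.range B) = Module.finrank ℂ (LinearMap.range (B * C * B)) := by rw [← h1]
      _ ≤ Module.finrank ℂ (LinearMap.range (B * C)) := Submodule.finrank_mono h2
      _ ≤ Module.finrank ℂ (LinearMap.range C) := by rw [h3]; exact Submodule.finrank_map_le _ _
  by_cases hex : ∃ x ∈ 𝔊, (∀ p ∈ H.piece 1 0, x p = 0) ∧ (∀ v, x v ∈ H.piece 1 0) ∧
      E * x + x * F - (2 : ℂ) • (E * x * F) ≠ 0
  · -- a non-zero Peirce-`1` raising element: rank count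
    right
    obtain ⟨x, hx, hxP, hxim, hx1⟩ := hex
    have hxB : x * B = 0 := LinearMap.ext fun v => by
      rw [Module.End.mul_apply, hxP _ (hBim v), LinearMap.zero_apply]
    have hBx : B * x = 0 := LinearMap.ext fun v => by
      rw [Module.End.mul_apply, hBP _ (hxim v), LinearMap.zero_apply]
    obtain ⟨-, hx1mem⟩ := WeightOnePeirce.peirceOne_mem hbr ht hBCB hCBC hBB hCC hE hF hB hC𝔊 hx hxB hBx
    have hx1P : ∀ p ∈ H.piece 1 0, (E * x + x * F - (2 : ℂ) • (E * x * F)) p = 0 := fun p hp => by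
      simp only [LinearMap.sub_apply, LinearMap.add_apply, LinearMap.smul_apply, Module.End.mul_apply, hFP p hp,
        hxP p hp, map_zero, smul_zero, add_zero, sub_zero]
    have hx1im : ∀ v, (E * x + x * F - (2 : ℂ) • (E * x * F)) v ∈ H.piece 1 0 := fun v => by
      simp only [LinearMap.sub_apply, LinearMap.add_apply, LinearMap.smul_apply, Module.End.mul_apply]
      exact Submodule.sub_mem _ (Submodule.add_mem _ (hEP _) (hxim _)) (Submodule.smul_mem _ _ (hEP _))
    have hr := hmin _ hx1mem hx1 hx1P hx1im
    have hsplit : E * x + x * F - (2 : ℂ) • (E * x * F) = (E * x - E * x * F) + (x * F - E * x * F) := by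
      rw [two_smul]; abel
    -- the component `(1 - E) x F` takes values in `(1 - E) P`, of dimension `≤ dim P - r`
    obtain ⟨φ, hφ⟩ : ∃ φ : H.piece 1 0 →ₗ[ℂ] ℂ ⊗[ℚ] V, φ = (1 - E).domRestrict (H.piece 1 0) := ⟨_, rfl⟩
    have hkerφ : Submodule.comap (H.piece 1 0).subtype (LinearMap.range B) ≤ LinearMap.ker φ := by
      rintro ⟨p, hp⟩ hpB
      obtain ⟨w, hw⟩ := LinearMap.mem_range.1 (Submodule.mem_comap.1 hpB)
      have hw' : B w = p := hw
      rw [LinearMap.mem_ker, hφ, LinearMap.domRestrict_apply]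
      change (1 - E) p = 0
      rw [← hw', LinearMap.sub_apply, Module.End.one_apply, ← Module.End.mul_apply, hEB, sub_self]
    have hdimkerφ : Module.finrank ℂ (LinearMap.range B) ≤ Module.finrank ℂ (LinearMap.ker φ) :=
      calc Module.finrank ℂ (LinearMap.range B)
          = Module.finrank ℂ (Submodule.comap (H.piece 1 0).subtype (LinearMap.range B)) :=
            (LinearEquiv.finrank_eq (Submodule.comapSubtypeEquivOfLe hBle)).symm
        _ ≤ Module.finrank ℂ (LinearMap.ker φ) := Submodule.finrank_mono hkerφ
    have hrnφ := LinearMap.finrank_range_add_finrank_ker φ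
    have ha' : LinearMap.range (x * F - E * x * F) ≤ LinearMap.range φ := by
      rintro _ ⟨v, rfl⟩
      refine ⟨⟨x (F v), hxim _⟩, ?_⟩
      rw [hφ, LinearMap.domRestrict_apply]
      change (1 - E) (x (F v)) = (x * F - E * x * F) v
      simp only [LinearMap.sub_apply, Module.End.one_apply, Module.End.mul_apply]
    have ha'dim := Submodule.finrank_mono ha'
    -- the component `E x (1 - F)` kills `P ⊕ range C`, so its rank is `≤ dim Q - r`
    obtain ⟨φ', hφ'⟩ : ∃ φ' : H.piece 0 1 →ₗ[ℂ] ℂ ⊗[ℚ] V, φ' = (E * x - E * x * F).domRestrict (H.piece 0 1) :=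
      ⟨_, rfl⟩
    have hkerφ' : Submodule.comap (H.piece 0 1).subtype (LinearMap.range C) ≤ LinearMap.ker φ' := by
      rintro ⟨q, hq⟩ hqC
      obtain ⟨w, hw⟩ := LinearMap.mem_range.1 (Submodule.mem_comap.1 hqC)
      have hw' : C w = q := hw
      rw [LinearMap.mem_ker, hφ', LinearMap.domRestrict_apply]
      change (E * x - E * x * F) q = 0
      rw [← hw', ← Module.End.mul_apply, sub_mul, mul_assoc (E * x) F C, hFC, sub_self, LinearMap.zero_apply]
    have hdimkerφ' : Module.finrank ℂ (LinearMap.range B) ≤ Module.finrank ℂ (LinearMap.ker φ') :=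
      calc Module.finrank ℂ (LinearMap.range B) ≤ Module.finrank ℂ (LinearMap.range C) := hrC
        _ = Module.finrank ℂ (Submodule.comap (H.piece 0 1).subtype (LinearMap.range C)) :=
            (LinearEquiv.finrank_eq (Submodule.comapSubtypeEquivOfLe hCle)).symm
        _ ≤ Module.finrank ℂ (LinearMap.ker φ') := Submodule.finrank_mono hkerφ'
    have hrnφ' := LinearMap.finrank_range_add_finrank_ker φ'
    have ha : LinearMap.range (E * x - E * x * F) ≤ LinearMap.range φ' := by
      rintro _ ⟨v, rfl⟩
      refine ⟨⟨(2 : ℂ)⁻¹ • (v - Θ v), hQmem v⟩, ?_⟩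
      rw [hφ', LinearMap.domRestrict_apply]
      change (E * x - E * x * F) ((2 : ℂ)⁻¹ • (v - Θ v)) = (E * x - E * x * F) v
      have hv : v = (2 : ℂ)⁻¹ • (v + Θ v) + (2 : ℂ)⁻¹ • (v - Θ v) := by module
      have hkill : (E * x - E * x * F) ((2 : ℂ)⁻¹ • (v + Θ v)) = 0 := by
        rw [LinearMap.sub_apply, Module.End.mul_apply, Module.End.mul_apply, Module.End.mul_apply,
          hFP _ (hPmem v), hxP _ (hPmem v), map_zero, map_zero, map_zero, sub_zero]
      conv_rhs => rw [hv, map_add, hkill, zero_add]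
    have hadim := Submodule.finrank_mono ha
    have hsymm : Module.finrank ℂ (H.piece 1 0) = Module.finrank ℂ (H.piece 0 1) := hodgeNumber_symm_holds H 1 0
    have hsum : Module.finrank ℂ (LinearMap.range (E * x + x * F - (2 : ℂ) • (E * x * F))) ≤
        Module.finrank ℂ (LinearMap.range (E * x - E * x * F)) +
          Module.finrank ℂ (LinearMap.range (x * F - E * x * F)) := by
      rw [hsplit]
      exact (Submodule.finrank_mono (LinearMap.range_add_le _ _)).trans
        (Submodule.finrank_add_le_finrank_add_finrank _ _)
    omega
  · -- every raising Peirce-`1` component vanishes: `range B ⊔ range C` is `𝔊`-stable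
    left
    push Not at hex
    have hR : ∀ x ∈ 𝔊, (∀ p ∈ H.piece 1 0, x p = 0) → (∀ v, x v ∈ H.piece 1 0) →
        ∀ v, x (C v) ∈ LinearMap.range B := fun x hx hxP hxim v =>
      WeightOnePeirce.apply_mem_range_of_raising ht hBCB hCBC hBB hCC hE hF (hex x hx hxP hxim) v
    have hL : ∀ l ∈ 𝔊, (∀ p ∈ H.piece 1 0, l p ∈ H.piece 1 0) → ∀ v, l (B v) ∈ LinearMap.range B := by
      intro l hl hlP v
      have hx : l * B - B * l ∈ 𝔊 := hbr l hl B hB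
      have hxP : ∀ p ∈ H.piece 1 0, (l * B - B * l) p = 0 := fun p hp => by
        rw [LinearMap.sub_apply, Module.End.mul_apply, Module.End.mul_apply, hBP p hp, map_zero, hBP _ (hlP p hp),
          sub_zero]
      have hxim : ∀ v, (l * B - B * l) v ∈ H.piece 1 0 := fun v => by
        rw [LinearMap.sub_apply, Module.End.mul_apply, Module.End.mul_apply]
        exact Submodule.sub_mem _ (hlP _ (hBim v)) (hBim _)
      exact WeightOnePeirce.apply_mem_range_of_levi ht hBCB hCBC hBB hCC hE hF (hex _ hx hxP hxim) v
    -- the lowering and conjugate-Levi versions, by conjugation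
    have hR' : ∀ y ∈ 𝔊, (∀ q ∈ H.piece 0 1, y q = 0) → (∀ v, y v ∈ H.piece 0 1) →
        ∀ v, y (B v) ∈ LinearMap.range C := by
      intro y hy hyQ hyim v
      obtain ⟨yb, hyb⟩ := exists_conjOp y
      have hybmem : yb ∈ 𝔊 := hconj y hy yb hyb
      have hybP : ∀ p ∈ H.piece 1 0, yb p = 0 := fun p hp => by
        rw [hyb, hyQ _ (conj_mem_piece H hp), map_zero]
      have hybim : ∀ v, yb v ∈ H.piece 1 0 := fun v => by
        rw [hyb]
        exact conj_mem_piece H (hyim _)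
      obtain ⟨w, hw⟩ := LinearMap.mem_range.1 (hR yb hybmem hybP hybim (conj v))
      have h : y (B v) = conj (yb (conj (B v))) := by rw [hyb, conj_conj, conj_conj]
      rw [h, hcB, ← hw, hcB]
      exact LinearMap.mem_range_self C _
    have hL' : ∀ l ∈ 𝔊, (∀ q ∈ H.piece 0 1, l q ∈ H.piece 0 1) → ∀ v, l (C v) ∈ LinearMap.range C := by
      intro l hl hlQ v
      obtain ⟨lb, hlb⟩ := exists_conjOp l
      have hlbmem : lb ∈ 𝔊 := hconj l hl lb hlb
      have hlbP : ∀ p ∈ H.piece 1 0, lb p ∈ H.piece 1 0 := fun p hp => by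
        rw [hlb]
        exact conj_mem_piece H (hlQ _ (conj_mem_piece H hp))
      obtain ⟨w, hw⟩ := LinearMap.mem_range.1 (hL lb hlbmem hlbP (conj v))
      have h : l (C v) = conj (lb (conj (C v))) := by rw [hlb, conj_conj, conj_conj]
      rw [h, hcC, ← hw, hcB]
      exact LinearMap.mem_range_self C _
    -- decomposition `Z = Z⁺ + Z⁻ + Z⁰`
    intro Z hZ s hs
    obtain ⟨Zp, hZp⟩ : ∃ Zp : Module.End ℂ (ℂ ⊗[ℚ] V), Zp = (4 : ℂ)⁻¹ • (Z + Θ * Z - Z * Θ - Θ * Z * Θ) := ⟨_, rfl⟩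
    obtain ⟨Zm, hZm⟩ : ∃ Zm : Module.End ℂ (ℂ ⊗[ℚ] V),
        Zm = (4 : ℂ)⁻¹ • (Z + (-Θ) * Z - Z * (-Θ) - (-Θ) * Z * (-Θ)) := ⟨_, rfl⟩
    have hΘΘ' : ∀ v, (-Θ) ((-Θ) v) = v := fun v => by
      rw [LinearMap.neg_apply, LinearMap.neg_apply, map_neg, neg_neg, hΘΘ]
    have hZpmem : Zp ∈ 𝔊 := hZp ▸ UnitaryTheta.raise_mem hbr hΘ𝔊 hΘΘ hZ
    have hZmmem : Zm ∈ 𝔊 := hZm ▸ UnitaryTheta.raise_mem hbr (Submodule.neg_mem _ hΘ𝔊) hΘΘ' hZ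
    have hZpP : ∀ p ∈ H.piece 1 0, Zp p = 0 := fun p hp => by
      rw [hZp]
      exact UnitaryTheta.raise_apply_of_eq Θ Z (hΘ10 p hp)
    have hZpim : ∀ v, Zp v ∈ H.piece 1 0 := fun v => hTfix _ (by
      rw [hZp]
      exact UnitaryTheta.apply_raise_apply hΘΘ Z v)
    have hZmQ : ∀ q ∈ H.piece 0 1, Zm q = 0 := fun q hq => by
      rw [hZm]
      exact UnitaryTheta.raise_apply_of_eq (-Θ) Z (by rw [LinearMap.neg_apply, hΘ01 q hq, neg_neg])
    have hZmim : ∀ v, Zm v ∈ H.piece 0 1 := fun v => hTneg _ (by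
      have h := UnitaryTheta.apply_raise_apply hΘΘ' Z v
      rw [LinearMap.neg_apply, neg_eq_iff_eq_neg] at h
      rw [hZm]
      exact h)
    obtain ⟨Z0, hZ0⟩ : ∃ Z0 : Module.End ℂ (ℂ ⊗[ℚ] V), Z0 = Z - Zp - Zm := ⟨_, rfl⟩
    have hZ0mem : Z0 ∈ 𝔊 := hZ0 ▸ Submodule.sub_mem _ (Submodule.sub_mem _ hZ hZpmem) hZmmem
    have hΘ2 : Θ * Θ = 1 := LinearMap.ext fun v => by rw [Module.End.mul_apply, hΘΘ, Module.End.one_apply]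
    have h1 : (-Θ) * Z = -(Θ * Z) := LinearMap.ext fun v => by simp only [Module.End.mul_apply, LinearMap.neg_apply]
    have h2 : Z * (-Θ) = -(Z * Θ) := LinearMap.ext fun v => by
      simp only [Module.End.mul_apply, LinearMap.neg_apply, map_neg]
    have h3 : (-Θ) * Z * (-Θ) = Θ * Z * Θ := LinearMap.ext fun v => by
      simp only [Module.End.mul_apply, LinearMap.neg_apply, map_neg, neg_neg]
    have hZ0eq : Z0 = (2 : ℂ)⁻¹ • (Z + Θ * Z * Θ) := by
      rw [hZ0, hZp, hZm, h3, h1, h2]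
      module
    have hcomm : Θ * Z0 = Z0 * Θ := by
      rw [hZ0eq, mul_smul_comm, smul_mul_assoc, mul_add, add_mul, show Θ * (Θ * Z * Θ) = (Θ * Θ) * Z * Θ by
        simp only [mul_assoc], mul_assoc (Θ * Z) Θ Θ, hΘ2, one_mul, mul_one, add_comm]
    have hZ0P : ∀ p ∈ H.piece 1 0, Z0 p ∈ H.piece 1 0 := fun p hp => hTfix _ (by
      rw [← Module.End.mul_apply, hcomm, Module.End.mul_apply, hΘ10 p hp])
    have hZ0Q : ∀ q ∈ H.piece 0 1, Z0 q ∈ H.piece 0 1 := fun q hq => hTneg _ (by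
      rw [← Module.End.mul_apply, hcomm, Module.End.mul_apply, hΘ01 q hq, map_neg])
    have hZsum : Z = Zp + Zm + Z0 := by rw [hZ0]; abel
    obtain ⟨u, hu, w, hw, rfl⟩ := Submodule.mem_sup.1 hs
    obtain ⟨u', rfl⟩ := LinearMap.mem_range.1 hu
    obtain ⟨w', rfl⟩ := LinearMap.mem_range.1 hw
    have h1S : Zp (C w') ∈ LinearMap.range B ⊔ LinearMap.range C :=
      Submodule.mem_sup_left (hR Zp hZpmem hZpP hZpim w')
    have h2S : Zm (B u') ∈ LinearMap.range B ⊔ LinearMap.range C :=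
      Submodule.mem_sup_right (hR' Zm hZmmem hZmQ hZmim u')
    have h3S : Z0 (B u') ∈ LinearMap.range B ⊔ LinearMap.range C := Submodule.mem_sup_left (hL Z0 hZ0mem hZ0P u')
    have h4S : Z0 (C w') ∈ LinearMap.range B ⊔ LinearMap.range C := Submodule.mem_sup_right (hL' Z0 hZ0mem hZ0Q w')
    have h5S : Zp (B u') ∈ LinearMap.range B ⊔ LinearMap.range C := by
      rw [hZpP _ (hBim u')]
      exact Submodule.zero_mem _
    have h6S : Zm (C w') ∈ LinearMap.range B ⊔ LinearMap.range C := by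
      rw [hZmQ _ (hCim w')]
      exact Submodule.zero_mem _
    rw [hZsum]
    simp only [LinearMap.add_apply, map_add]
    apply_rules [Submodule.add_mem]

/-! ## §3 Consequences under irreducibility: `r = dim V^{1,0}` (plus line) or `3 r ≤ 2 dim V^{1,0}`; `dim V^{1,0} = 6 ⟹ r ≠ 5` -/

/-- **Minimal raising rank: `r = dim V^{1,0}` or `3 r ≤ 2 dim V^{1,0}`**, when `V_ℂ` has no `𝔊`-stable subspace other than `0`
and `V_ℂ` (for `𝔊 = 𝔥_ℂ` and `End_Hdg = ℚ` this is the tree's `SymplecticTheta.eq_bot_or_top_of_stable`): in the stable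
case of `stable_or_three_mul_rank_le`, `range B ⊔ range C = V_ℂ` has dimension `2 dim V^{1,0} ≤ r + dim V^{0,1}`.
[cite: MoonenZarhin1999LowDim, §2 (2.3)–(2.5)] [cite: Deligne1982HodgeCycles, I §3 (proof of Prop. 3.4, 3.6)] -/
theorem WeightOnePeirce.finrank_range_eq_or_three_mul_le (H : HodgeStructure V n) (ψ : H.Polarization) (hn : n = 1)
    (heff : H.IsEffective) {Θ : Module.End ℂ (ℂ ⊗[ℚ] V)} (hΘ : ∀ p, ∀ x ∈ H.piece p (n - p), Θ x = ((2 * p - n : ℤ) : ℂ) • x)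
    {𝔊 : Submodule ℂ (Module.End ℂ (ℂ ⊗[ℚ] V))} (h𝔊 : 𝔊 ≤ H.hodgeLieC) (hbr : ∀ Y ∈ 𝔊, ∀ Z ∈ 𝔊, Y * Z - Z * Y ∈ 𝔊)
    (hΘ𝔊 : Θ ∈ 𝔊) (hconj : ∀ Z ∈ 𝔊, ∀ Z' : Module.End ℂ (ℂ ⊗[ℚ] V), (∀ v, Z' v = conj (Z (conj v))) → Z' ∈ 𝔊)
    (hirr : ∀ U : Submodule ℂ (ℂ ⊗[ℚ] V), (∀ Z ∈ 𝔊, ∀ u ∈ U, Z u ∈ U) → U = ⊥ ∨ U = ⊤)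
    {B C : Module.End ℂ (ℂ ⊗[ℚ] V)} (hB : B ∈ 𝔊) (hB0 : B ≠ 0) (hBP : ∀ p ∈ H.piece 1 0, B p = 0)
    (hBim : ∀ v, B v ∈ H.piece 1 0) (hC : ∀ v, C v = conj (B (conj v)))
    (hmin : ∀ B' ∈ 𝔊, B' ≠ 0 → (∀ p ∈ H.piece 1 0, B' p = 0) → (∀ v, B' v ∈ H.piece 1 0) →
      Module.finrank ℂ (LinearMap.range B) ≤ Module.finrank ℂ (LinearMap.range B')) :
    Module.finrank ℂ (LinearMap.range B) = Module.finrank ℂ (H.piece 1 0) ∨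
      3 * Module.finrank ℂ (LinearMap.range B) ≤ 2 * Module.finrank ℂ (H.piece 1 0) := by
  classical
  rcases WeightOnePeirce.stable_or_three_mul_rank_le H ψ hn heff hΘ h𝔊 hbr hΘ𝔊 hconj hB hB0 hBP hBim hC hmin with
    hst | h3
  · left
    subst hn
    obtain ⟨hPmem, hQmem, hΘ10, hΘ01, -⟩ := UnitaryTheta.theta_facts H rfl heff hΘ
    obtain ⟨-, hCim, -, -⟩ := SymplecticThetaTen.conjOp_raise (P := H.piece 1 0) (Q := H.piece 0 1)
      (fun x hx => conj_mem_piece H hx) (fun x hx => conj_mem_piece H hx) hBP hBim hC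
    have hBle : LinearMap.range B ≤ H.piece 1 0 := by
      rintro _ ⟨w, rfl⟩
      exact hBim w
    have hCle : LinearMap.range C ≤ H.piece 0 1 := by
      rintro _ ⟨w, rfl⟩
      exact hCim w
    rcases hirr _ hst with hbot | htop
    · exfalso
      refine hB0 (LinearMap.ext fun v => ?_)
      have h : B v ∈ LinearMap.range B ⊔ LinearMap.range C := Submodule.mem_sup_left (LinearMap.mem_range_self B v)
      rw [hbot, Submodule.mem_bot] at h
      rw [h, LinearMap.zero_apply]
    · have hPQ : ∀ v, (2 : ℂ)⁻¹ • (v + Θ v) + (2 : ℂ)⁻¹ • (v - Θ v) = v := fun v => by module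
      have hsup : H.piece 1 0 ⊔ H.piece 0 1 = ⊤ := by
        rw [eq_top_iff]
        intro v _
        rw [← hPQ v]
        exact Submodule.add_mem_sup (hPmem v) (hQmem v)
      have hinf : H.piece 1 0 ⊓ H.piece 0 1 = ⊥ := by
        rw [eq_bot_iff]
        intro x hx
        rw [Submodule.mem_bot]
        have h1 := hΘ10 x hx.1
        rw [hΘ01 x hx.2, neg_eq_iff_add_eq_zero, ← two_smul ℂ x, smul_eq_zero] at h1
        exact h1.resolve_left (two_ne_zero' ℂ)
      have hsum := Submodule.finrank_sup_add_finrank_inf_eq (H.piece 1 0) (H.piece 0 1)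
      rw [hsup, hinf, finrank_top, finrank_bot, add_zero] at hsum
      have hsymm : Module.finrank ℂ (H.piece 1 0) = Module.finrank ℂ (H.piece 0 1) := hodgeNumber_symm_holds H 1 0
      have htop' := Submodule.finrank_add_le_finrank_add_finrank (LinearMap.range B) (LinearMap.range C)
      rw [htop, finrank_top] at htop'
      have h1 := Submodule.finrank_mono hBle
      have h2 := Submodule.finrank_mono hCle
      omega
  · exact Or.inr h3

/-- **The plus-line exit: if the minimal raising rank is `dim V^{1,0}`, every raising `B' ∈ 𝔊` has `B' B̄'|_{V^{1,0}}` scalar**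
(every non-zero raising `B'` then has full rank, is minimal as well, hence a tripotent `B' B̄' B' = t' B'` with `range B' = V^{1,0}`)
— the hypothesis `hscalar` of the tree's `SymplecticThetaTen.plusLine_of_forall_scalar`. [cite: MoonenZarhin1999LowDim, §2 (2.3)–(2.5)]
[cite: Deligne1982HodgeCycles, I §3 (proof of Prop. 3.4, 3.6)] -/
theorem WeightOnePeirce.forall_scalar_of_finrank_range_eq (H : HodgeStructure V n) (ψ : H.Polarization) (hn : n = 1)
    (heff : H.IsEffective) {Θ : Module.End ℂ (ℂ ⊗[ℚ] V)} (hΘ : ∀ p, ∀ x ∈ H.piece p (n - p), Θ x = ((2 * p - n : ℤ) : ℂ) • x)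
    {𝔊 : Submodule ℂ (Module.End ℂ (ℂ ⊗[ℚ] V))} (h𝔊 : 𝔊 ≤ H.hodgeLieC) (hbr : ∀ Y ∈ 𝔊, ∀ Z ∈ 𝔊, Y * Z - Z * Y ∈ 𝔊)
    (hconj : ∀ Z ∈ 𝔊, ∀ Z' : Module.End ℂ (ℂ ⊗[ℚ] V), (∀ v, Z' v = conj (Z (conj v))) → Z' ∈ 𝔊)
    {B : Module.End ℂ (ℂ ⊗[ℚ] V)}
    (hmin : ∀ B' ∈ 𝔊, B' ≠ 0 → (∀ p ∈ H.piece 1 0, B' p = 0) → (∀ v, B' v ∈ H.piece 1 0) →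
      Module.finrank ℂ (LinearMap.range B) ≤ Module.finrank ℂ (LinearMap.range B'))
    (hr : Module.finrank ℂ (LinearMap.range B) = Module.finrank ℂ (H.piece 1 0)) :
    ∀ B' ∈ 𝔊, (∀ p ∈ H.piece 1 0, B' p = 0) → (∀ v, B' v ∈ H.piece 1 0) →
      ∀ C' : Module.End ℂ (ℂ ⊗[ℚ] V), (∀ v, C' v = conj (B' (conj v))) →
        ∃ μ : ℂ, ∀ p ∈ H.piece 1 0, B' (C' p) = μ • p := by
  classical
  intro B' hB' hB'P hB'im C' hC'
  by_cases hB'0 : B' = 0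
  · exact ⟨0, fun p _ => by rw [hB'0, LinearMap.zero_apply, zero_smul]⟩
  have hB'le : LinearMap.range B' ≤ H.piece 1 0 := by
    rintro _ ⟨w, rfl⟩
    exact hB'im w
  have hrange : LinearMap.range B' = H.piece 1 0 :=
    Submodule.eq_of_le_of_finrank_eq hB'le (le_antisymm (Submodule.finrank_mono hB'le) (hr ▸ hmin B' hB' hB'0 hB'P hB'im))
  have hmin' : ∀ B'' ∈ 𝔊, B'' ≠ 0 → (∀ p ∈ H.piece 1 0, B'' p = 0) → (∀ v, B'' v ∈ H.piece 1 0) →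
      Module.finrank ℂ (LinearMap.range B') ≤ Module.finrank ℂ (LinearMap.range B'') := fun B'' hB'' h0 h1 h2 =>
    (Submodule.finrank_mono hB'le).trans (hr ▸ hmin B'' hB'' h0 h1 h2)
  obtain ⟨t', -, hBCB'⟩ := WeightOneMinimalRaising.mul_conjOp_mul_eq_smul H ψ hn heff hΘ h𝔊 hbr hB' hB'0 hB'P hB'im hC'
    (hconj B' hB' C' hC') hmin'
  refine ⟨t', fun p hp => ?_⟩
  obtain ⟨w, rfl⟩ := LinearMap.mem_range.1 (hrange.symm ▸ hp : p ∈ LinearMap.range B')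
  rw [← Module.End.mul_apply, ← Module.End.mul_apply, hBCB', LinearMap.smul_apply]

/-- **`dim V^{1,0} = 6`: the minimal raising rank is not `5`** (it is `6`, the plus line, or at most `4`): the case of the cell's
TABLE X row 1 (`dim_ℚ V = 12`). [cite: MoonenZarhin1999LowDim, §2 (2.3)–(2.5)] [cite: Deligne1982HodgeCycles, I §3 (proof of Prop. 3.4, 3.6)] -/
theorem WeightOnePeirce.finrank_range_ne_five (H : HodgeStructure V n) (ψ : H.Polarization) (hn : n = 1)
    (heff : H.IsEffective) {Θ : Module.End ℂ (ℂ ⊗[ℚ] V)} (hΘ : ∀ p, ∀ x ∈ H.piece p (n - p), Θ x = ((2 * p - n : ℤ) : ℂ) • x)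
    {𝔊 : Submodule ℂ (Module.End ℂ (ℂ ⊗[ℚ] V))} (h𝔊 : 𝔊 ≤ H.hodgeLieC) (hbr : ∀ Y ∈ 𝔊, ∀ Z ∈ 𝔊, Y * Z - Z * Y ∈ 𝔊)
    (hΘ𝔊 : Θ ∈ 𝔊) (hconj : ∀ Z ∈ 𝔊, ∀ Z' : Module.End ℂ (ℂ ⊗[ℚ] V), (∀ v, Z' v = conj (Z (conj v))) → Z' ∈ 𝔊)
    (hirr : ∀ U : Submodule ℂ (ℂ ⊗[ℚ] V), (∀ Z ∈ 𝔊, ∀ u ∈ U, Z u ∈ U) → U = ⊥ ∨ U = ⊤)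
    {B C : Module.End ℂ (ℂ ⊗[ℚ] V)} (hB : B ∈ 𝔊) (hB0 : B ≠ 0) (hBP : ∀ p ∈ H.piece 1 0, B p = 0)
    (hBim : ∀ v, B v ∈ H.piece 1 0) (hC : ∀ v, C v = conj (B (conj v)))
    (hmin : ∀ B' ∈ 𝔊, B' ≠ 0 → (∀ p ∈ H.piece 1 0, B' p = 0) → (∀ v, B' v ∈ H.piece 1 0) →
      Module.finrank ℂ (LinearMap.range B) ≤ Module.finrank ℂ (LinearMap.range B'))
    (hP6 : Module.finrank ℂ (H.piece 1 0) = 6) : Module.finrank ℂ (LinearMap.range B) ≠ 5 := by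
  have h := WeightOnePeirce.finrank_range_eq_or_three_mul_le H ψ hn heff hΘ h𝔊 hbr hΘ𝔊 hconj hirr hB hB0 hBP hBim hC hmin
  omega

end HodgeStructure

end Literature.AlgebraicGeometry.Motives
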